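import Literature.Geometry.Symplectic.OrigamiSphereProofs
import Literature.Geometry.Kaehler.ManifoldFormsPullback
import HarnessLib

/-!
# The hypotheses of `ContactSphereFoldRigidity` hold on the round sphere (non-vacuity of the rung)

Support file for item stmt-SmoothPoincare4-14077 (`ContactSphereFoldRigidity`, route
SmoothPoincare4/SymplecticOrigami — the top-rung recogniser: a homotopy 4-sphere carrying a folded
symplectic form whose fold is an embedded `S³` with trace of CONTACT TYPE is `S⁴`). This file
certifies that the hypotheses of that item are satisfiable in the tree's exact vocabulary, at
`M = S⁴`: with the origami form `s = ω₀|_{S⁴}` (`sphereOrigamiForm`, Cannas da Silva–Guillemin–Pires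
2010, Example 2.3) folded along the equator `j : S³ ↪ S⁴` (`equatorIncl`,
`isFoldedForm_sphereOrigamiForm`), the trace `σ = j^*s = s.pullback (𝓡 3) j` is `dα`
(`mextDeriv α = σ`) for the smooth 1-form `α = ½ (x₁ dy₁ - y₁ dx₁ + x₂ dy₂ - y₂ dx₂)|_{S³}` (the
standard contact form: the pull-back of the Liouville form `λ₀ = ½ ι_p ω₀` of `ℝ⁵ = ℂ² × ℝ` along
`S³ ↪ S⁴ ↪ ℝ⁵`), and `α` does not vanish on the characteristic line field `ker σ` (the Hopf
direction) — the item's last hypothesis, verbatim. So the rung is not vacuous, and (with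
`Homeomorph.refl`, `Diffeomorph.refl`) consistent.

* `extDeriv_liouville`, `mextDeriv_liouville` — `dλ₀ = ω₀` on `ℝ⁵` (Mathlib's `extDeriv` of a form
  linear in the point), for any continuous linear `L` with `L p w = ½ ω₀(p, w₀)`;
* `presymplectic_ne_zero_of_kernel` — the linear algebra on `T_n S³ = n^⊥ ⊂ ℂ²`: if `u ≠ 0` and
  `ω₀(u, ·)` vanishes on `n^⊥` then `ω₀(n, u) ≠ 0` (test vector `Ju - ⟪Ju, n⟫ n`);
* `exists_contactForm_equatorTrace`, `contactSphereFold_hypotheses_sphere` — assembly through the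
  tree's pull-back calculus (`isSmoothForm_pullback`, `mextDeriv_pullback`, `MForm.pullback_comp`)
  and Mathlib's `range_mfderiv_coe_sphere` / `mfderiv_coe_sphere_injective`.

No definitions, notations, instances or named facts are introduced (the Liouville form is the
explicit continuous linear map `p ↦ ½ ω₀(p, ·)` built inside the final proof).
-/

noncomputable section

-- the prescribed namespace `Summit.<P>.<Sub>.…` duplicates `SmoothPoincare4` (P = Sub)
set_option linter.dupNamespace false

open scoped Manifold ContDiff Topology InnerProductSpace
open Set Function
open Literature.Geometry.Kaehler Literature.Geometry.Symplectic

namespace Summit.SmoothPoincare4.SmoothPoincare4.Theorems.ContactSphereFoldRigidity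

/-! ### The Liouville form `λ₀` on `ℝ⁵` and `dλ₀ = ω₀` -/

/-- **`dλ₀ = ω₀`** on `ℝ⁵`: for a continuous linear `L : p ↦ (w ↦ ½ ω₀(p, w₀))` (the Liouville
1-form, linear in the point), `d(⇑L) = ω₀` at every point (Mathlib's normalisation of `extDeriv`:
`dλ(v₀, v₁) = Dλ(v₀)(v₁) - Dλ(v₁)(v₀) = ½ ω₀(v₀, v₁) - ½ ω₀(v₁, v₀) = ω₀(v₀, v₁)`). [folklore] -/
theorem extDeriv_liouville
    (L : EuclideanSpace ℝ (Fin 5) →L[ℝ] (EuclideanSpace ℝ (Fin 5) [⋀^Fin 1]→L[ℝ] ℝ))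
    (hL : ∀ (p : EuclideanSpace ℝ (Fin 5)) (w : Fin 1 → EuclideanSpace ℝ (Fin 5)),
      L p w = 2⁻¹ * presymplecticBilinFive p (w 0))
    (p : EuclideanSpace ℝ (Fin 5)) :
    extDeriv (⇑L) p = presymplecticAltFive := by
  rw [extDeriv, ContinuousLinearMap.fderiv]
  ext v
  rw [ContinuousAlternatingMap.alternatizeUncurryFin_apply]
  have hv : v = ![v 0, v 1] := by
    ext i : 1
    fin_cases i <;> rfl
  conv_rhs => rw [hv]
  rw [presymplecticAltFive_apply]
  simp only [hL, presymplecticBilinFive_apply]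
  simp [Fin.removeNth]
  ring

/-- In the identity chart of the model space `ℝ⁵` the chart representative of a form is the form
itself (as in the tree's `mextDeriv_eq_extDeriv`). [folklore] -/
theorem inChart_flat (α : MForm 𝓘(ℝ, EuclideanSpace ℝ (Fin 5)) (EuclideanSpace ℝ (Fin 5)) ℝ 1)
    (x : EuclideanSpace ℝ (Fin 5)) : MForm.inChart α x = α := by
  funext y
  ext v
  simp
  rfl

/-- A form on `ℝ⁵` that is (continuous) linear in the point is a smooth form. [folklore] -/
theorem isSmoothForm_liouville
    (L : EuclideanSpace ℝ (Fin 5) →L[ℝ] (EuclideanSpace ℝ (Fin 5) [⋀^Fin 1]→L[ℝ] ℝ))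
    (Λ : MForm 𝓘(ℝ, EuclideanSpace ℝ (Fin 5)) (EuclideanSpace ℝ (Fin 5)) ℝ 1)
    (hΛ : Λ = fun q => L q) : IsSmoothForm Λ := by
  intro x
  rw [inChart_flat, hΛ]
  exact L.contDiff.contDiffAt.contDiffWithinAt

/-- **`dλ₀ = ω₀` as forms on the manifold `ℝ⁵`** (`mextDeriv` is `extDeriv` in the flat case).
[folklore] -/
theorem mextDeriv_liouville
    (L : EuclideanSpace ℝ (Fin 5) →L[ℝ] (EuclideanSpace ℝ (Fin 5) [⋀^Fin 1]→L[ℝ] ℝ))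
    (hL : ∀ (p : EuclideanSpace ℝ (Fin 5)) (w : Fin 1 → EuclideanSpace ℝ (Fin 5)),
      L p w = 2⁻¹ * presymplecticBilinFive p (w 0))
    (Λ : MForm 𝓘(ℝ, EuclideanSpace ℝ (Fin 5)) (EuclideanSpace ℝ (Fin 5)) ℝ 1)
    (hΛ : Λ = fun q => L q) : mextDeriv Λ = presymplecticMFormFive := by
  funext p
  rw [mextDeriv_eq_extDeriv, hΛ]
  exact extDeriv_liouville L hL p

/-! ### The equator and the derivative of `S³ ↪ S⁴ ↪ ℝ⁵` -/

/-- `ι₅ ∘ j = pad ∘ ι₄` for the equator inclusion `j`. [folklore] -/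
theorem val_comp_equatorIncl :
    (Subtype.val : (Metric.sphere (0 : EuclideanSpace ℝ (Fin 5)) 1) → EuclideanSpace ℝ (Fin 5)) ∘
        equatorIncl =
      padFive.toContinuousLinearMap ∘
        (Subtype.val : (Metric.sphere (0 : EuclideanSpace ℝ (Fin 4)) 1) → EuclideanSpace ℝ (Fin 4)) :=
  rfl

/-- The composite `S³ ↪ S⁴ ↪ ℝ⁵` is `C^∞`. [folklore] -/
theorem contMDiff_val_comp_equatorIncl :
    ContMDiff (𝓡 3) 𝓘(ℝ, EuclideanSpace ℝ (Fin 5)) ∞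
      ((Subtype.val : (Metric.sphere (0 : EuclideanSpace ℝ (Fin 5)) 1) → EuclideanSpace ℝ (Fin 5)) ∘
        equatorIncl) := by
  haveI : Fact (Module.finrank ℝ (EuclideanSpace ℝ (Fin 5)) = 4 + 1) := ⟨finrank_euclideanSpace_fin⟩
  exact (contMDiff_coe_sphere (E := EuclideanSpace ℝ (Fin 5)) (n := 4)).comp contMDiff_equatorIncl

/-- For a tangent vector `u` to `S³` at `n`, `d(ι₅ ∘ j)(u) = pad (dι₄ u)`: the derivative of the
composite `S³ ↪ S⁴ ↪ ℝ⁵` factors through `ℝ⁴ ↪ ℝ⁵` (re-proved from the tree's private lemma of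
`OrigamiSphereProofs`). [folklore] -/
theorem mfderiv_val_comp_equatorIncl (n : (Metric.sphere (0 : EuclideanSpace ℝ (Fin 4)) 1))
    (u : TangentSpace (𝓡 3) n) :
    (mfderiv (𝓡 3) 𝓘(ℝ, EuclideanSpace ℝ (Fin 5))
        ((Subtype.val : (Metric.sphere (0 : EuclideanSpace ℝ (Fin 5)) 1) → EuclideanSpace ℝ (Fin 5)) ∘
          equatorIncl) n u : EuclideanSpace ℝ (Fin 5)) =
      padFive (mfderiv (𝓡 3) 𝓘(ℝ, EuclideanSpace ℝ (Fin 4))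
        (Subtype.val : (Metric.sphere (0 : EuclideanSpace ℝ (Fin 4)) 1) → EuclideanSpace ℝ (Fin 4))
          n u : EuclideanSpace ℝ (Fin 4)) := by
  haveI : Fact (Module.finrank ℝ (EuclideanSpace ℝ (Fin 4)) = 3 + 1) := ⟨finrank_euclideanSpace_fin⟩
  have hval3 : MDifferentiableAt (𝓡 3) 𝓘(ℝ, EuclideanSpace ℝ (Fin 4))
      (Subtype.val : (Metric.sphere (0 : EuclideanSpace ℝ (Fin 4)) 1) → EuclideanSpace ℝ (Fin 4)) n :=
    (contMDiff_coe_sphere (E := EuclideanSpace ℝ (Fin 4)) (n := 3) n).mdifferentiableAt one_ne_zero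
  have h3 := mfderiv_comp n (padFive.toContinuousLinearMap.hasMFDerivAt.mdifferentiableAt) hval3
    (I' := 𝓘(ℝ, EuclideanSpace ℝ (Fin 4))) (I'' := 𝓘(ℝ, EuclideanSpace ℝ (Fin 5)))
    (g := padFive.toContinuousLinearMap)
  rw [← val_comp_equatorIncl, ContinuousLinearMap.mfderiv_eq] at h3
  exact congrArg (fun L => L u) h3

/-- `dι₅ (dj u) = pad (dι₄ u)` (chain rule through `S⁴`). [folklore] -/
theorem mfderiv_val_mfderiv_equatorIncl (n : (Metric.sphere (0 : EuclideanSpace ℝ (Fin 4)) 1))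
    (u : TangentSpace (𝓡 3) n) :
    (mfderiv (𝓡 4) 𝓘(ℝ, EuclideanSpace ℝ (Fin 5))
        (Subtype.val : (Metric.sphere (0 : EuclideanSpace ℝ (Fin 5)) 1) → EuclideanSpace ℝ (Fin 5))
        (equatorIncl n) (mfderiv (𝓡 3) (𝓡 4) equatorIncl n u) : EuclideanSpace ℝ (Fin 5)) =
      padFive (mfderiv (𝓡 3) 𝓘(ℝ, EuclideanSpace ℝ (Fin 4))
        (Subtype.val : (Metric.sphere (0 : EuclideanSpace ℝ (Fin 4)) 1) → EuclideanSpace ℝ (Fin 4))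
          n u : EuclideanSpace ℝ (Fin 4)) := by
  haveI : Fact (Module.finrank ℝ (EuclideanSpace ℝ (Fin 5)) = 4 + 1) := ⟨finrank_euclideanSpace_fin⟩
  have hj : MDifferentiableAt (𝓡 3) (𝓡 4) equatorIncl n :=
    contMDiff_equatorIncl.mdifferentiableAt (by simp)
  have hval : MDifferentiableAt (𝓡 4) 𝓘(ℝ, EuclideanSpace ℝ (Fin 5))
      (Subtype.val : (Metric.sphere (0 : EuclideanSpace ℝ (Fin 5)) 1) → EuclideanSpace ℝ (Fin 5))
      (equatorIncl n) :=
    (contMDiff_coe_sphere (E := EuclideanSpace ℝ (Fin 5)) (n := 4) (equatorIncl n)).mdifferentiableAt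
      one_ne_zero
  have h1 := mfderiv_comp n hval hj
  rw [← mfderiv_val_comp_equatorIncl, h1]
  rfl

/-! ### Linear algebra on the equator: `α` does not vanish on `ker σ` -/

/-- `ω₀(pad a, pad b) = a₀b₁ - a₁b₀ + a₂b₃ - a₃b₂`. [folklore] -/
theorem presymplecticAltFive_padFive (a b : EuclideanSpace ℝ (Fin 4)) :
    presymplecticAltFive ![padFive a, padFive b] = a 0 * b 1 - a 1 * b 0 + a 2 * b 3 - a 3 * b 2 := by
  rw [presymplecticAltFive_apply]
  simp

/-- **The key linear-algebra step.** Let `n ∈ S³ ⊂ ℂ²`, `u ≠ 0`, and suppose `ω₀(u, u') = 0`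
for every `u' ⊥ n` (for `u ⊥ n`: `u` spans the characteristic line of `ω₀|_{T_n S³}`). Then
`ω₀(n, u) ≠ 0` — i.e. the Liouville form `½ ω₀(n, ·)` does not vanish on `u`. (Test against
`u' = Ju - ⟪Ju, n⟫ n ⊥ n`: `0 = ω₀(u, u') = ‖u‖² - ⟪Ju, n⟫²`, while `ω₀(n, u) = -⟪Ju, n⟫`.)
[folklore] -/
theorem presymplectic_ne_zero_of_kernel (n : (Metric.sphere (0 : EuclideanSpace ℝ (Fin 4)) 1))
    {u : EuclideanSpace ℝ (Fin 4)} (hune : u ≠ 0)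
    (H : ∀ u' : EuclideanSpace ℝ (Fin 4), ⟪(n : EuclideanSpace ℝ (Fin 4)), u'⟫_ℝ = 0 →
      presymplecticAltFive ![padFive u, padFive u'] = 0) :
    presymplecticBilinFive (padFive (n : EuclideanSpace ℝ (Fin 4))) (padFive u) ≠ 0 := by
  have hnormsq : ∀ v : EuclideanSpace ℝ (Fin 4), ‖v‖ ^ 2 = v 0 ^ 2 + v 1 ^ 2 + v 2 ^ 2 + v 3 ^ 2 :=
    fun v => by rw [EuclideanSpace.real_norm_sq_eq, Fin.sum_univ_four]
  have hinner : ∀ V W : EuclideanSpace ℝ (Fin 4),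
      ⟪V, W⟫_ℝ = V 0 * W 0 + V 1 * W 1 + V 2 * W 2 + V 3 * W 3 := fun V W => by
    simp [PiLp.inner_apply, Fin.sum_univ_four, mul_comm]
  set m : EuclideanSpace ℝ (Fin 4) := (n : EuclideanSpace ℝ (Fin 4)) with hm
  have hn1 : ‖m‖ ^ 2 = 1 := by rw [hm, norm_eq_of_mem_sphere n, one_pow]
  rw [hnormsq] at hn1
  -- `c = ⟪Ju, n⟫`
  set c : ℝ := u 0 * m 1 - u 1 * m 0 + u 2 * m 3 - u 3 * m 2 with hc
  -- the test vector `u' = Ju - c n`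
  set u' : EuclideanSpace ℝ (Fin 4) :=
    WithLp.toLp 2 ![-(u 1) - c * m 0, u 0 - c * m 1, -(u 3) - c * m 2, u 2 - c * m 3] with hu'
  have hu'0 : u' 0 = -(u 1) - c * m 0 := rfl
  have hu'1 : u' 1 = u 0 - c * m 1 := rfl
  have hu'2 : u' 2 = -(u 3) - c * m 2 := rfl
  have hu'3 : u' 3 = u 2 - c * m 3 := rfl
  have hperp : ⟪m, u'⟫_ℝ = 0 := by
    rw [hinner, hu'0, hu'1, hu'2, hu'3]
    linear_combination (-c) * hn1
  have h0 := H u' hperp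
  rw [presymplecticAltFive_padFive, hu'0, hu'1, hu'2, hu'3] at h0
  -- `h0 : ‖u‖² - c² = 0` (after expansion)
  intro habs
  rw [presymplecticBilinFive_apply] at habs
  simp only [padFive_apply_zero, padFive_apply_one, padFive_apply_two, padFive_apply_three] at habs
  -- `habs : -c = 0`
  have hc0 : c = 0 := by linear_combination -habs
  have hsq : u 0 ^ 2 + u 1 ^ 2 + u 2 ^ 2 + u 3 ^ 2 = 0 := by
    linear_combination h0 + c * hc0
  apply hune
  have h0' : ‖u‖ = 0 := by
    have : ‖u‖ ^ 2 = 0 := by rw [hnormsq]; exact hsq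
    exact pow_eq_zero_iff two_ne_zero |>.1 this
  exact norm_eq_zero.1 h0'

/-! ### The contact trace of the origami sphere -/

/-- Every vector orthogonal to `n` is `dι₄ w` for some tangent vector `w` to `S³` at `n`
(Mathlib's `range_mfderiv_coe_sphere`). [folklore] -/
theorem exists_mfderiv_val_sphere_three_eq (n : (Metric.sphere (0 : EuclideanSpace ℝ (Fin 4)) 1))
    {U : EuclideanSpace ℝ (Fin 4)} (hU : ⟪(n : EuclideanSpace ℝ (Fin 4)), U⟫_ℝ = 0) :
    ∃ w : TangentSpace (𝓡 3) n,
      (mfderiv (𝓡 3) 𝓘(ℝ, EuclideanSpace ℝ (Fin 4))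
        (Subtype.val : (Metric.sphere (0 : EuclideanSpace ℝ (Fin 4)) 1) → EuclideanSpace ℝ (Fin 4))
          n w : EuclideanSpace ℝ (Fin 4)) = U := by
  haveI : Fact (Module.finrank ℝ (EuclideanSpace ℝ (Fin 4)) = 3 + 1) := ⟨finrank_euclideanSpace_fin⟩
  have h : U ∈ (ℝ ∙ (n : EuclideanSpace ℝ (Fin 4)))ᗮ :=
    (Submodule.mem_orthogonal_singleton_iff_inner_right).2 hU
  rw [← range_mfderiv_coe_sphere (E := EuclideanSpace ℝ (Fin 4)) (n := 3) n] at h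
  obtain ⟨w, hw⟩ := h
  exact ⟨w, hw⟩

/-- **The equatorial trace of the origami sphere is of contact type.** There is a smooth 1-form
`α` on `S³` (the standard contact form `½ (x₁ dy₁ - y₁ dx₁ + x₂ dy₂ - y₂ dx₂)|_{S³}`, the
pull-back of the Liouville form of `ℝ⁵ = ℂ² × ℝ` along `S³ ↪ S⁴ ↪ ℝ⁵`) with
`dα = j^*(ω₀|_{S⁴})` for the equator `j : S³ ↪ S⁴`, which does not vanish on the characteristic
line field of `j^*(ω₀|_{S⁴})` (the Hopf direction). [folklore] -/
theorem exists_contactForm_equatorTrace :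
    ∃ α : MForm (𝓡 3) (Metric.sphere (0 : EuclideanSpace ℝ (Fin 4)) 1) ℝ 1, IsSmoothForm α ∧
      mextDeriv α = sphereOrigamiForm.pullback (𝓡 3) equatorIncl ∧
      ∀ (n : (Metric.sphere (0 : EuclideanSpace ℝ (Fin 4)) 1)) (v : TangentSpace (𝓡 3) n), v ≠ 0 →
        (∀ w : TangentSpace (𝓡 3) n, sphereOrigamiForm.pullback (𝓡 3) equatorIncl n ![v, w] = 0) →
          α n ![v] ≠ 0 := by
  haveI : Fact (Module.finrank ℝ (EuclideanSpace ℝ (Fin 4)) = 3 + 1) := ⟨finrank_euclideanSpace_fin⟩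
  haveI : Fact (Module.finrank ℝ (EuclideanSpace ℝ (Fin 5)) = 4 + 1) := ⟨finrank_euclideanSpace_fin⟩
  -- the Liouville form `λ₀ = ½ ι_p ω₀` of `ℝ⁵`, linear in the point
  set L : EuclideanSpace ℝ (Fin 5) →L[ℝ] (EuclideanSpace ℝ (Fin 5) [⋀^Fin 1]→L[ℝ] ℝ) :=
    ContinuousLinearMap.comp
      ((2⁻¹ : ℝ) • ContinuousLinearEquiv.toContinuousLinearMap
        (LinearIsometryEquiv.toContinuousLinearEquiv
          (ContinuousAlternatingMap.ofSubsingletonLIE (𝕜 := ℝ) (E := EuclideanSpace ℝ (Fin 5))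
            (F := ℝ) (0 : Fin 1))))
      presymplecticBilinFive with hLdef
  have hL : ∀ (p : EuclideanSpace ℝ (Fin 5)) (w : Fin 1 → EuclideanSpace ℝ (Fin 5)),
      L p w = 2⁻¹ * presymplecticBilinFive p (w 0) := by
    intro p w
    rw [hLdef]
    simp
  set Λ : MForm 𝓘(ℝ, EuclideanSpace ℝ (Fin 5)) (EuclideanSpace ℝ (Fin 5)) ℝ 1 := fun q => L q with hΛ
  have hΛapply : ∀ (p : EuclideanSpace ℝ (Fin 5)) (w : Fin 1 → EuclideanSpace ℝ (Fin 5)),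
      Λ p w = 2⁻¹ * presymplecticBilinFive p (w 0) := fun p w => hL p w
  set f : (Metric.sphere (0 : EuclideanSpace ℝ (Fin 4)) 1) → EuclideanSpace ℝ (Fin 5) :=
    (Subtype.val : (Metric.sphere (0 : EuclideanSpace ℝ (Fin 5)) 1) → EuclideanSpace ℝ (Fin 5)) ∘
      equatorIncl with hf
  have hfs : ContMDiff (𝓡 3) 𝓘(ℝ, EuclideanSpace ℝ (Fin 5)) ∞ f := contMDiff_val_comp_equatorIncl
  have hΛs : IsSmoothForm Λ := isSmoothForm_liouville L Λ hΛ
  have hval : MDifferentiable (𝓡 4) 𝓘(ℝ, EuclideanSpace ℝ (Fin 5))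
      (Subtype.val : (Metric.sphere (0 : EuclideanSpace ℝ (Fin 5)) 1) → EuclideanSpace ℝ (Fin 5)) :=
    (contMDiff_coe_sphere (E := EuclideanSpace ℝ (Fin 5)) (n := 4)).mdifferentiable one_ne_zero
  have hj : MDifferentiable (𝓡 3) (𝓡 4) equatorIncl :=
    contMDiff_equatorIncl.mdifferentiable (by simp)
  refine ⟨MForm.pullback (𝓡 3) f Λ, ?_, ?_, ?_⟩
  · exact Literature.NumberTheory.Transcendental.isSmoothForm_pullback hfs hΛs
  · rw [Literature.NumberTheory.Transcendental.mextDeriv_pullback hfs hΛs,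
      mextDeriv_liouville L hL Λ hΛ, sphereOrigamiForm, ← MForm.pullback_comp hval hj]
  · intro n v hv hker
    -- `u = dι₄ v ≠ 0`
    set u : EuclideanSpace ℝ (Fin 4) := (mfderiv (𝓡 3) 𝓘(ℝ, EuclideanSpace ℝ (Fin 4))
      (Subtype.val : (Metric.sphere (0 : EuclideanSpace ℝ (Fin 4)) 1) → EuclideanSpace ℝ (Fin 4)) n v :
        EuclideanSpace ℝ (Fin 4)) with hu
    have hune : u ≠ 0 := by
      intro h0
      apply hv
      have hinj := mfderiv_coe_sphere_injective (E := EuclideanSpace ℝ (Fin 4)) (n := 3) n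
      apply hinj
      rw [map_zero]
      exact h0
    -- the kernel hypothesis read in `ℝ⁵`
    have H : ∀ u' : EuclideanSpace ℝ (Fin 4), ⟪(n : EuclideanSpace ℝ (Fin 4)), u'⟫_ℝ = 0 →
        presymplecticAltFive ![padFive u, padFive u'] = 0 := by
      intro u' hu'
      obtain ⟨w, hw⟩ := exists_mfderiv_val_sphere_three_eq n hu'
      have h := hker w
      rw [MForm.pullback_apply] at h
      have h2 : (fun i => mfderiv (𝓡 3) (𝓡 4) equatorIncl n (![v, w] i)) =
          ![mfderiv (𝓡 3) (𝓡 4) equatorIncl n v, mfderiv (𝓡 3) (𝓡 4) equatorIncl n w] := by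
        funext i
        fin_cases i <;> rfl
      rw [h2, sphereOrigamiForm_apply, mfderiv_val_mfderiv_equatorIncl,
        mfderiv_val_mfderiv_equatorIncl, hw] at h
      exact h
    have key := presymplectic_ne_zero_of_kernel n hune H
    -- the value of `α` on `v` is `½ ω₀(pad n, pad u)`
    have h5 : (mfderiv (𝓡 3) 𝓘(ℝ, EuclideanSpace ℝ (Fin 5)) f n v : EuclideanSpace ℝ (Fin 5)) =
        padFive u :=
      mfderiv_val_comp_equatorIncl n v
    rw [MForm.pullback_apply, hΛapply]
    change 2⁻¹ * presymplecticBilinFive (padFive (n : EuclideanSpace ℝ (Fin 4)))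
      (mfderiv (𝓡 3) 𝓘(ℝ, EuclideanSpace ℝ (Fin 5)) f n v) ≠ 0
    rw [h5]
    exact mul_ne_zero (by norm_num) key

/-- **The hypotheses of `ContactSphereFoldRigidity` hold at `M = S⁴`** (non-vacuity of the rung):
the round 4-sphere carries a folded symplectic form `s = ω₀|_{S⁴}` whose fold is the embedded
3-sphere `j(S³)` (the equator), with trace `j^*s = dα` of contact type (`α` smooth, non-vanishing on
the characteristic line field `ker j^*s`). With `Homeomorph.refl S⁴` this instantiates every
hypothesis of the item; its conclusion holds there by `Diffeomorph.refl`. [folklore] -/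
theorem contactSphereFold_hypotheses_sphere :
    ∃ (s : MForm (𝓡 4) (Metric.sphere (0 : EuclideanSpace ℝ (Fin 5)) 1) ℝ 2)
      (j : (Metric.sphere (0 : EuclideanSpace ℝ (Fin 4)) 1) → (Metric.sphere (0 : EuclideanSpace ℝ (Fin 5)) 1))
      (α : MForm (𝓡 3) (Metric.sphere (0 : EuclideanSpace ℝ (Fin 4)) 1) ℝ 1),
      IsFoldedForm s (Metric.sphere (0 : EuclideanSpace ℝ (Fin 4)) 1) j ∧ IsSmoothForm α ∧
      mextDeriv α = s.pullback (𝓡 3) j ∧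
      ∀ (n : (Metric.sphere (0 : EuclideanSpace ℝ (Fin 4)) 1)) (v : TangentSpace (𝓡 3) n), v ≠ 0 →
        (∀ w : TangentSpace (𝓡 3) n, s.pullback (𝓡 3) j n ![v, w] = 0) → α n ![v] ≠ 0 := by
  obtain ⟨α, h1, h2, h3⟩ := exists_contactForm_equatorTrace
  exact ⟨sphereOrigamiForm, equatorIncl, α, isFoldedForm_sphereOrigamiForm, h1, h2, h3⟩

/-- Conversion between the two spellings of "`dα` is the trace of `s` along `j`": the equation of
2-forms `mextDeriv α = s.pullback (𝓡 3) j` holds iff it holds on every pair `![v, w]` with the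
pull-back unfolded (`MForm.pullback_apply`); this is the bridge between the item's signature as first
filed (with `MForm.pullback`) and as repaired (pullback-free, refuter 2026-08-16). -/
theorem mextDeriv_eq_pullback_iff {M : Type*} [TopologicalSpace M]
    [ChartedSpace (EuclideanSpace ℝ (Fin 4)) M] (s : MForm (𝓡 4) M ℝ 2)
    (j : (Metric.sphere (0 : EuclideanSpace ℝ (Fin 4)) 1) → M)
    (α : MForm (𝓡 3) (Metric.sphere (0 : EuclideanSpace ℝ (Fin 4)) 1) ℝ 1) :
    mextDeriv α = s.pullback (𝓡 3) j ↔
      ∀ (n : (Metric.sphere (0 : EuclideanSpace ℝ (Fin 4)) 1)) (v w : TangentSpace (𝓡 3) n),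
        mextDeriv α n ![v, w] = s (j n) ![mfderiv (𝓡 3) (𝓡 4) j n v, mfderiv (𝓡 3) (𝓡 4) j n w] := by
  constructor
  · intro h n v w
    rw [h, MForm.pullback_apply]
    congr 1
    ext i : 1
    fin_cases i <;> rfl
  · intro h
    funext n
    ext v
    rw [MForm.pullback_apply]
    have hv : v = ![v 0, v 1] := by
      ext i : 1
      fin_cases i <;> rfl
    rw [hv, h n (v 0) (v 1)]
    congr 1
    ext i : 1
    fin_cases i <;> rfl

/-- Pointwise unfolding of the pulled-back 2-form on a pair of tangent vectors. -/
theorem pullback_apply_pair {M : Type*} [TopologicalSpace M]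
    [ChartedSpace (EuclideanSpace ℝ (Fin 4)) M] (s : MForm (𝓡 4) M ℝ 2)
    (j : (Metric.sphere (0 : EuclideanSpace ℝ (Fin 4)) 1) → M)
    (n : (Metric.sphere (0 : EuclideanSpace ℝ (Fin 4)) 1)) (v w : TangentSpace (𝓡 3) n) :
    s.pullback (𝓡 3) j n ![v, w] = s (j n) ![mfderiv (𝓡 3) (𝓡 4) j n v, mfderiv (𝓡 3) (𝓡 4) j n w] := by
  rw [MForm.pullback_apply]
  congr 1
  ext i : 1
  fin_cases i <;> rfl

/-- NON-VACUITY of `ContactSphereFoldRigidity` in the REPAIRED (pullback-free) spelling of the item's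
signature (ledger `set-signature`, 2026-08-16): at `M = S⁴` the hypotheses hold verbatim with
`s = sphereOrigamiForm`, `j = equatorIncl` and `α` the standard contact form of `S³`. -/
theorem contactSphereFold_hypotheses_sphere_pointwise :
    ∃ (s : MForm (𝓡 4) (Metric.sphere (0 : EuclideanSpace ℝ (Fin 5)) 1) ℝ 2)
      (j : (Metric.sphere (0 : EuclideanSpace ℝ (Fin 4)) 1) → (Metric.sphere (0 : EuclideanSpace ℝ (Fin 5)) 1))
      (α : MForm (𝓡 3) (Metric.sphere (0 : EuclideanSpace ℝ (Fin 4)) 1) ℝ 1),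
      IsFoldedForm s (Metric.sphere (0 : EuclideanSpace ℝ (Fin 4)) 1) j ∧ IsSmoothForm α ∧
      (∀ (n : (Metric.sphere (0 : EuclideanSpace ℝ (Fin 4)) 1)) (v w : TangentSpace (𝓡 3) n),
        mextDeriv α n ![v, w] = s (j n) ![mfderiv (𝓡 3) (𝓡 4) j n v, mfderiv (𝓡 3) (𝓡 4) j n w]) ∧
      ∀ (n : (Metric.sphere (0 : EuclideanSpace ℝ (Fin 4)) 1)) (v : TangentSpace (𝓡 3) n), v ≠ 0 →
        (∀ w : TangentSpace (𝓡 3) n,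
          s (j n) ![mfderiv (𝓡 3) (𝓡 4) j n v, mfderiv (𝓡 3) (𝓡 4) j n w] = 0) → α n ![v] ≠ 0 := by
  obtain ⟨s, j, α, hF, hα, hd, hk⟩ := contactSphereFold_hypotheses_sphere
  refine ⟨s, j, α, hF, hα, (mextDeriv_eq_pullback_iff s j α).1 hd, fun n v hv hw => hk n v hv ?_⟩
  intro w
  rw [pullback_apply_pair]
  exact hw w

end Summit.SmoothPoincare4.SmoothPoincare4.Theorems.ContactSphereFoldRigidity

end
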